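import Mathlib
import Summits.ValiantsHypothesis.ValiantsHypothesis.Theses.BarrierLever
import Literature.Computability.AlgebraicComplexity.ArithCircuitProofs
import Literature.Computability.AlgebraicComplexity.IMMInVPProofs
import Summits.ValiantsHypothesis.ValiantsHypothesis.Theorems.DivisionGapZeroOneTransferStubSqrtCheap

/-!
# Crux `BarrierLever.DefinableEquations` (stmt-ValiantsHypothesis-8745) — equations are MONOTONE
# in `n` at the price of the size exponent (lead c5)

Write `Eq(n, b, a)` for the crux's inner statement at one `n`: some level-`a` boolean sum
(`q ≤ N^a`, `L(H), deg H ≤ N^a`, `N = C(2n,n)`) is nonzero and vanishes at `coeff(f)` for every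
`f ∈ SmallCircuits ℂ n b`.  The crux is `∃ a ∀ b, Eq(n, b, a) for all large n`; its infinitely-often
form `DefEq_io` (file `…InfinitelyOften.lean`) is what the assembly consumes.

THEOREM (`eq_succ_of_eq`).  For `n ≥ 2^(b+4)`:  `Eq(n, b+4, a) → Eq(n+1, b, a)`.

PROOF.  Restrict-and-truncate: for `f ∈ SmallCircuits ℂ (n+1) b` let `p = f(x₁,…,x_n,0)`
(`MvPolynomial.killCompl` along `Fin.castSucc`; `L(p) ≤ L(f)` by the substitution bound
`complexity_aeval_le`, `deg p ≤ n+1`) and `g = Σ_{k ≤ n} p_k` its truncation to degree `≤ n`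
(homogeneous components are cheap: `L(p_k) ≤ (n+2)(L(p)+n+2)`,
`SqrtCheap.complexity_homogeneousComponent_le`); then `g ∈ SmallCircuits ℂ n (b+4)` and
`coeff_m(g) = coeff_{ι m}(f)` for every exponent `m` of degree `≤ n`, where `ι` pads `m` by a zero
`x_{n+1}`-exponent (`coeff_killCompl`).  So a witness `H'` at `n` against `SmallCircuits ℂ n (b+4)`,
renamed along `ι` (`boolSum_rename_sumMap`, `rename_injective`, `complexity_rename_le`), is a
witness at `n+1` against `SmallCircuits ℂ (n+1) b`; budgets transfer since `C(2n,n) ≤ C(2n+2,n+1)`. ∎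

COROLLARY (`io_runs`).  `DefEq_io` (one level `a`, every `b`, infinitely often in `n`) already
gives, for every `b` and `k`, infinitely many RUNS `n, n+1, …, n+k` of consecutive good `n`
(apply `DefEq_io` at `b + 4k` and shift `j ≤ k` times).  So the gap between the filed crux
("all large `n`") and the consumed crux ("infinitely many `n`") is only the LENGTH OF GAPS between
good `n`, never their local structure; and a refutation of the filed crux at `(a, b)` must produce
bad `n` beyond every run supplied by `Eq(·, b + 4k, a)`.  Pure bookkeeping over the tree's
definitions; no definitions, no facts.
-/

set_option linter.dupNamespace false

noncomputable section

namespace Summit.ValiantsHypothesis.ValiantsHypothesis.Theorems.BarrierLeverDefinableEquations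

open MvPolynomial
open Literature.Computability.AlgebraicComplexity Literature.Barriers.ValiantsHypothesis
open scoped BigOperators

namespace ShiftInN

/-- Arithmetic for the restriction step: for `n ≥ 2^(b+4)`,
`(n+1) ((n+2) ((n+1)^b + n + 2)) + (n+1) ≤ n^(b+4)`. [folklore] -/
theorem restrict_arith {n b : ℕ} (hn : 2 ^ (b + 4) ≤ n) :
    (n + 1) * ((n + 2) * ((n + 1) ^ b + n + 2)) + (n + 1) ≤ n ^ (b + 4) := by
  have h16 : 16 ≤ n := le_trans (by
    calc (16 : ℕ) = 2 ^ 4 := by norm_num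
      _ ≤ 2 ^ (b + 4) := Nat.pow_le_pow_right (by norm_num) (by omega)) hn
  have h2b : 2 ^ b ≤ n := le_trans (Nat.pow_le_pow_right (by norm_num) (by omega)) hn
  have hpos : 1 ≤ n ^ b := Nat.one_le_pow _ _ (by omega)
  -- (n+1)^b ≤ (2n)^b = 2^b n^b ≤ n · n^b
  have hA : (n + 1) ^ b ≤ n ^ (b + 1) := by
    calc (n + 1) ^ b ≤ (2 * n) ^ b := Nat.pow_le_pow_left (by omega) b
      _ = 2 ^ b * n ^ b := by rw [mul_pow]
      _ ≤ n * n ^ b := Nat.mul_le_mul_right _ h2b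
      _ = n ^ (b + 1) := by ring
  have hn1 : n ≤ n ^ (b + 1) := by
    calc n = n * 1 := (mul_one n).symm
      _ ≤ n * n ^ b := Nat.mul_le_mul_left _ hpos
      _ = n ^ (b + 1) := by ring
  have hB : (n + 1) ^ b + n + 2 ≤ 3 * n ^ (b + 1) := by omega
  calc (n + 1) * ((n + 2) * ((n + 1) ^ b + n + 2)) + (n + 1)
      ≤ (2 * n) * ((2 * n) * (3 * n ^ (b + 1))) + 2 * n := by gcongr <;> omega
    _ = 12 * (n * n * n ^ (b + 1)) + 2 * n := by ring
    _ ≤ 12 * (n * n * n ^ (b + 1)) + 2 * (n * n * n ^ (b + 1)) := by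
        gcongr
        calc n = n * 1 * 1 := by ring
          _ ≤ n * n * n ^ (b + 1) := by gcongr <;> omega
    _ = 14 * n ^ (b + 3) := by ring
    _ ≤ n * n ^ (b + 3) := Nat.mul_le_mul_right _ (by omega)
    _ = n ^ (b + 4) := by ring

/-- **Restrict-and-truncate.**  For `n ≥ 2^(b+4)` and `f ∈ SmallCircuits ℂ (n+1) b` there is
`g ∈ SmallCircuits ℂ n (b+4)` whose coefficients are the coefficients of `f` at the exponents
padded by a zero `x_{n+1}`-exponent: `coeff m g = coeff (m.mapDomain Fin.castSucc) f` for every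
`m` of degree `≤ n` (`g` = truncation to degree `≤ n` of `f(x₁,…,x_n,0)`). [folklore] -/
theorem exists_restrict {n b : ℕ} (hn : 2 ^ (b + 4) ≤ n) (f : MvPolynomial (Fin (n + 1)) ℂ)
    (hf : f ∈ SmallCircuits ℂ (n + 1) b) :
    ∃ g ∈ SmallCircuits ℂ n (b + 4), ∀ m : Fin n →₀ ℕ, m.degree ≤ n →
      coeff m g = coeff (m.mapDomain Fin.castSucc) f := by
  classical
  obtain ⟨hfdeg, hfc⟩ := hf
  have hinj : Function.Injective (Fin.castSucc : Fin n → Fin (n + 1)) := Fin.castSucc_injective n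
  -- `p = f(x₁, …, x_n, 0)`
  set p : MvPolynomial (Fin n) ℂ := killCompl hinj f with hp
  have hpc : complexity p ≤ complexity f := by
    rw [hp]
    unfold MvPolynomial.killCompl
    refine (complexity_aeval_le _ _).trans (le_of_eq ?_)
    rw [Finset.sum_eq_zero, add_zero]
    intro i _
    split_ifs
    · exact complexity_X_holds _
    · have := complexity_C_holds (σ := Fin n) (0 : ℂ)
      rwa [map_zero] at this
  have hpdeg : p.totalDegree ≤ n + 1 := by
    refine Finset.sup_le fun s hs => ?_
    have hs' : s.mapDomain Fin.castSucc ∈ f.support := by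
      rw [MvPolynomial.mem_support_iff] at hs ⊢
      rwa [hp, coeff_killCompl] at hs
    have h1 := le_totalDegree hs'
    rw [Finsupp.sum_mapDomain_index_inj hinj] at h1
    exact h1.trans hfdeg
  -- `g` = truncation of `p` to degree `≤ n`
  set g : MvPolynomial (Fin n) ℂ := ∑ k ∈ Finset.range (n + 1), homogeneousComponent k p with hg
  refine ⟨g, ⟨?_, ?_⟩, ?_⟩
  · -- degree
    refine totalDegree_finsetSum_le fun k hk => ?_
    have hk' : k ≤ n := by simpa [Finset.mem_range, Nat.lt_succ_iff] using hk
    exact (homogeneousComponent_isHomogeneous k p).totalDegree_le.trans hk'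
  · -- size
    have hcomp : ∀ k, complexity (homogeneousComponent k p) ≤ (n + 2) * ((n + 1) ^ b + n + 2) := by
      intro k
      have h1 := Summit.ValiantsHypothesis.ValiantsHypothesis.Theorems.DivisionGapZeroOneTransfer.SqrtCheap.complexity_homogeneousComponent_le
        p hpdeg k
      rw [Fintype.card_fin] at h1
      refine h1.trans ?_
      have h2 : complexity p + n + 2 ≤ (n + 1) ^ b + n + 2 := by
        have := hpc.trans hfc
        omega
      exact Nat.mul_le_mul (by omega) h2
    calc complexity g ≤ ∑ k ∈ Finset.range (n + 1), complexity (homogeneousComponent k p) +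
          (Finset.range (n + 1)).card := complexity_finset_sum_le _ _
      _ ≤ ∑ k ∈ Finset.range (n + 1), (n + 2) * ((n + 1) ^ b + n + 2) +
          (Finset.range (n + 1)).card :=
        Nat.add_le_add_right (Finset.sum_le_sum fun k _ => hcomp k) _
      _ = (n + 1) * ((n + 2) * ((n + 1) ^ b + n + 2)) + (n + 1) := by
          rw [Finset.sum_const, Finset.card_range, smul_eq_mul]
      _ ≤ n ^ (b + 4) := restrict_arith hn
  · -- coefficients
    intro m hm
    rw [hg, coeff_sum]
    simp only [coeff_homogeneousComponent]
    rw [Finset.sum_ite_eq (Finset.range (n + 1)) m.degree (fun _ => coeff m p)]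
    rw [if_pos (by simpa [Finset.mem_range, Nat.lt_succ_iff] using hm)]
    rw [hp, coeff_killCompl]

/-- `C(2n, n) ≤ C(2n+2, n+1)` (central binomial coefficients increase). [folklore] -/
theorem centralChoose_le_succ (n : ℕ) :
    Nat.choose (2 * n) n ≤ Nat.choose (2 * (n + 1)) (n + 1) := by
  rw [← Nat.centralBinom_eq_two_mul_choose, ← Nat.centralBinom_eq_two_mul_choose]
  have h := Nat.succ_mul_centralBinom_succ n
  -- (n+1) * centralBinom (n+1) = 2 * (2n+1) * centralBinom n ≥ (n+1) * centralBinom n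
  have h2 : (n + 1) * Nat.centralBinom n ≤ (n + 1) * Nat.centralBinom (n + 1) := by
    rw [h]
    calc (n + 1) * Nat.centralBinom n ≤ (2 * (2 * n + 1)) * Nat.centralBinom n :=
          Nat.mul_le_mul_right _ (by omega)
      _ = 2 * (2 * n + 1) * Nat.centralBinom n := by ring
  exact Nat.le_of_mul_le_mul_left h2 (Nat.succ_pos n)

/-- **Monotonicity in `n` at the price of the size exponent.**  For `n ≥ 2^(b+4)`: a nonzero
level-`a` boolean-sum equation against `SmallCircuits ℂ n (b+4)` yields one (same level `a`,
same `q`) against `SmallCircuits ℂ (n+1) b` — rename the witness along the zero-padding of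
exponents and feed it the restrict-and-truncate `g` of `exists_restrict`. [folklore] -/
theorem eq_succ_of_eq {a b n : ℕ} (hn : 2 ^ (b + 4) ≤ n)
    (h : ∃ q : ℕ, q ≤ (Nat.choose (2 * n) n) ^ a ∧
      ∃ H : MvPolynomial (↥(degLEMonomials n) ⊕ Fin q) ℂ,
        complexity H ≤ (Nat.choose (2 * n) n) ^ a ∧ H.totalDegree ≤ (Nat.choose (2 * n) n) ^ a ∧
        boolSum H ≠ 0 ∧
        ∀ f ∈ SmallCircuits ℂ n (b + 4), eval (coeffVector (degLEMonomials n) f) (boolSum H) = 0) :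
    ∃ q : ℕ, q ≤ (Nat.choose (2 * (n + 1)) (n + 1)) ^ a ∧
      ∃ H : MvPolynomial (↥(degLEMonomials (n + 1)) ⊕ Fin q) ℂ,
        complexity H ≤ (Nat.choose (2 * (n + 1)) (n + 1)) ^ a ∧
        H.totalDegree ≤ (Nat.choose (2 * (n + 1)) (n + 1)) ^ a ∧
        boolSum H ≠ 0 ∧
        ∀ f ∈ SmallCircuits ℂ (n + 1) b,
          eval (coeffVector (degLEMonomials (n + 1)) f) (boolSum H) = 0 := by
  classical
  obtain ⟨q, hq, H, hHc, hHd, hne, hvan⟩ := h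
  have hN : (Nat.choose (2 * n) n) ^ a ≤ (Nat.choose (2 * (n + 1)) (n + 1)) ^ a :=
    Nat.pow_le_pow_left (centralChoose_le_succ n) a
  -- zero-padding of exponents `Fin n →₀ ℕ` ↪ `Fin (n+1) →₀ ℕ`, degree preserved
  let ι : ↥(degLEMonomials n) → ↥(degLEMonomials (n + 1)) := fun m =>
    ⟨(m : Fin n →₀ ℕ).mapDomain Fin.castSucc, by
      have hm : (m : Fin n →₀ ℕ).degree ≤ n := m.2
      show ((m : Fin n →₀ ℕ).mapDomain Fin.castSucc).degree ≤ n + 1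
      rw [Finsupp.degree_mapDomain]
      omega⟩
  have hι : Function.Injective ι := by
    intro x y hxy
    apply Subtype.ext
    have h1 := congrArg Subtype.val hxy
    exact Finsupp.mapDomain_injective (Fin.castSucc_injective n) h1
  refine ⟨q, hq.trans hN, MvPolynomial.rename (Sum.map ι id) H, ?_, ?_, ?_, ?_⟩
  · exact (complexity_rename_le_holds' _ _).trans (hHc.trans hN)
  · exact (MvPolynomial.totalDegree_rename_le _ _).trans (hHd.trans hN)
  · rw [boolSum_rename_sumMap]
    exact fun hz => hne (MvPolynomial.rename_injective ι hι (by rw [hz, map_zero]))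
  · intro f hf
    rw [boolSum_rename_sumMap, MvPolynomial.eval_rename]
    obtain ⟨g, hg, hcoeff⟩ := exists_restrict hn f hf
    have hcoe : (coeffVector (degLEMonomials (n + 1)) f) ∘ ι = coeffVector (degLEMonomials n) g := by
      funext m
      have hm : (m : Fin n →₀ ℕ).degree ≤ n := m.2
      simp only [Function.comp_apply, coeffVector_apply]
      exact (hcoeff _ hm).symm
    rw [hcoe]
    exact hvan g hg

/-- Monotonicity in the size exponent at fixed `n ≥ 1`: an equation against `SmallCircuits ℂ n b'`
is one against `SmallCircuits ℂ n b` for `b ≤ b'`. [folklore] -/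
theorem eq_mono_b {a b b' n : ℕ} (hbb : b ≤ b') (hn : 1 ≤ n)
    (h : ∃ q : ℕ, q ≤ (Nat.choose (2 * n) n) ^ a ∧
      ∃ H : MvPolynomial (↥(degLEMonomials n) ⊕ Fin q) ℂ,
        complexity H ≤ (Nat.choose (2 * n) n) ^ a ∧ H.totalDegree ≤ (Nat.choose (2 * n) n) ^ a ∧
        boolSum H ≠ 0 ∧
        ∀ f ∈ SmallCircuits ℂ n b', eval (coeffVector (degLEMonomials n) f) (boolSum H) = 0) :
    ∃ q : ℕ, q ≤ (Nat.choose (2 * n) n) ^ a ∧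
      ∃ H : MvPolynomial (↥(degLEMonomials n) ⊕ Fin q) ℂ,
        complexity H ≤ (Nat.choose (2 * n) n) ^ a ∧ H.totalDegree ≤ (Nat.choose (2 * n) n) ^ a ∧
        boolSum H ≠ 0 ∧
        ∀ f ∈ SmallCircuits ℂ n b, eval (coeffVector (degLEMonomials n) f) (boolSum H) = 0 := by
  obtain ⟨q, hq, H, hHc, hHd, hne, hvan⟩ := h
  exact ⟨q, hq, H, hHc, hHd, hne, fun f hf => hvan f (smallCircuits_mono ℂ hbb hn hf)⟩

/-- **Infinitely often ⇒ arbitrarily long runs.**  If one level `a` serves every `b` infinitely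
often in `n` (`DefEq_io`), then for every `b` and `k` there are infinitely many `n` such that
`Eq(n + j, b, a)` holds for ALL `j ≤ k` (apply the hypothesis at `b + 4k` beyond `2^(b+4k)` and
shift with `eq_succ_of_eq`). [folklore] -/
theorem io_runs
    (h : ∃ a : ℕ, ∀ b n₀ : ℕ, ∃ n : ℕ, n₀ ≤ n ∧ ∃ q : ℕ, q ≤ (Nat.choose (2 * n) n) ^ a ∧
      ∃ H : MvPolynomial (↥(degLEMonomials n) ⊕ Fin q) ℂ,
        complexity H ≤ (Nat.choose (2 * n) n) ^ a ∧ H.totalDegree ≤ (Nat.choose (2 * n) n) ^ a ∧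
        boolSum H ≠ 0 ∧
        ∀ f ∈ SmallCircuits ℂ n b, eval (coeffVector (degLEMonomials n) f) (boolSum H) = 0) :
    ∃ a : ℕ, ∀ b k n₀ : ℕ, ∃ n : ℕ, n₀ ≤ n ∧ ∀ j ≤ k, ∃ q : ℕ, q ≤ (Nat.choose (2 * (n + j)) (n + j)) ^ a ∧
      ∃ H : MvPolynomial (↥(degLEMonomials (n + j)) ⊕ Fin q) ℂ,
        complexity H ≤ (Nat.choose (2 * (n + j)) (n + j)) ^ a ∧
        H.totalDegree ≤ (Nat.choose (2 * (n + j)) (n + j)) ^ a ∧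
        boolSum H ≠ 0 ∧
        ∀ f ∈ SmallCircuits ℂ (n + j) b,
          eval (coeffVector (degLEMonomials (n + j)) f) (boolSum H) = 0 := by
  obtain ⟨a, ha⟩ := h
  refine ⟨a, fun b k => ?_⟩
  induction k generalizing b with
  | zero =>
    intro n₀
    obtain ⟨n, hn, hrest⟩ := ha b n₀
    refine ⟨n, hn, fun j hj => ?_⟩
    obtain rfl : j = 0 := Nat.le_zero.mp hj
    simpa using hrest
  | succ k ih =>
    intro n₀
    obtain ⟨n, hn, hrun⟩ := ih (b + 4) (max n₀ (2 ^ (b + 4)))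
    have hn₀ : n₀ ≤ n := le_trans (le_max_left _ _) hn
    have hnb : 2 ^ (b + 4) ≤ n := le_trans (le_max_right _ _) hn
    have hn1 : 1 ≤ n := le_trans (Nat.one_le_two_pow) hnb
    refine ⟨n, hn₀, fun j hj => ?_⟩
    rcases j with _ | j
    · -- j = 0: monotonicity in b at n
      have h0 := hrun 0 (Nat.zero_le _)
      simp only [Nat.add_zero] at h0 ⊢
      exact eq_mono_b (by omega) hn1 h0
    · -- j + 1: shift from n + j
      have hj' : j ≤ k := by omega
      have hprev := hrun j hj'
      exact eq_succ_of_eq (a := a) (b := b) (n := n + j) (by omega) hprev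

end ShiftInN

/-- **Registered sub-goal `eq_succ_of_eq` (verbatim signature).**  Equations against
`SmallCircuits` are monotone in `n` at the price of the size exponent: for `n ≥ 2^(b+4)`,
`Eq(n, b+4, a) → Eq(n+1, b, a)` (`ShiftInN.eq_succ_of_eq`). [folklore] -/
theorem eq_succ_of_eq :
    ∀ a b n : ℕ, 2 ^ (b + 4) ≤ n → (∃ q : ℕ, q ≤ (Nat.choose (2 * n) n) ^ a ∧ ∃ H : MvPolynomial (↥(Literature.Barriers.ValiantsHypothesis.degLEMonomials n) ⊕ Fin q) ℂ, Literature.Computability.AlgebraicComplexity.complexity H ≤ (Nat.choose (2 * n) n) ^ a ∧ H.totalDegree ≤ (Nat.choose (2 * n) n) ^ a ∧ Literature.Computability.AlgebraicComplexity.boolSum H ≠ 0 ∧ ∀ f ∈ Literature.Barriers.ValiantsHypothesis.SmallCircuits ℂ n (b + 4), MvPolynomial.eval (Literature.Barriers.ValiantsHypothesis.coeffVector (Literature.Barriers.ValiantsHypothesis.degLEMonomials n) f) (Literature.Computability.AlgebraicComplexity.boolSum H) = 0) → ∃ q : ℕ, q ≤ (Nat.choose (2 * (n + 1)) (n + 1))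 ^ a ∧ ∃ H : MvPolynomial (↥(Literature.Barriers.ValiantsHypothesis.degLEMonomials (n + 1)) ⊕ Fin q) ℂ, Literature.Computability.AlgebraicComplexity.complexity H ≤ (Nat.choose (2 * (n + 1)) (n + 1)) ^ a ∧ H.totalDegree ≤ (Nat.choose (2 * (n + 1)) (n + 1)) ^ a ∧ Literature.Computability.AlgebraicComplexity.boolSum H ≠ 0 ∧ ∀ f ∈ Literature.Barriers.ValiantsHypothesis.SmallCircuits ℂ (n + 1) b, MvPolynomial.eval (Literature.Barriers.ValiantsHypothesis.coeffVector (Literature.Barriers.ValiantsHypothesis.degLEMonomials (n + 1)) f) (Literature.Computability.AlgebraicComplexity.boolSum H) = 0 :=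
  fun _ _ _ hn h => ShiftInN.eq_succ_of_eq hn h

end Summit.ValiantsHypothesis.ValiantsHypothesis.Theorems.BarrierLeverDefinableEquations

end
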